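import Summits.QuantumAdvantage.QuantumAdvantage.Theorems.InnerDegreeLawsJ
import Summits.QuantumAdvantage.QuantumAdvantage.Theorems.LivenessSeparationLawB
import Summits.QuantumAdvantage.QuantumAdvantage.Theorems.LivenessSeparationLawF

set_option linter.dupNamespace false

/-!
# LIVENESS SEPARATION, part M (lens 4, g28 cycle 4d) — the DESIGNED-CLASS RECTANGLE KILL (pure silencing; the game side of «SeparatedQuadNoPerfectOdd»)

Blocker `X = AbsorptionDial.NoPerfectPolyOdd` (item 28487); NODE-g28 §5g.  LIVENESS DESIGN (paper Lemma D, §5g): for a 2-separated set `Q` of exceptional cuts and a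
block inside a gap of `Q`, the frozen bits `ρ` and the class `τ` can be CHOSEN so that one member `g₀ ∈ Q` is live and every other member is DEAD on the class
(unless `Q` is the ends pair with `n ≡ c`).  Given such a design, no merging is needed: silencing `Q ∖ {g₀}` (part J's class normal form with an EMPTY live set) leaves
the win bits on the class unchanged, the silenced strategy is `k`-form except `g₀`, and `g₀`'s register is UNCHANGED — so the tree's one-label rectangle technology
applies verbatim on the class: `loss_of_designedClassRectangle` = part J (`winsOn_class_normalForm`, `classNormalForm_*`) ∘ part F (`rectRank_le_of_winsOn`) ∘ the
tree's `rank_famPat_flat_ge`.  Hypotheses are those of the tree's `loss_of_columnSaturatedRectangle` with «registers `k`-form except `g₀`» weakened to «`k`-form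
outside `Q`, and `Q ∖ {g₀}` dead at one input of the class», plus the class condition on the rectangle.  (It is also the `t = 1` reading of part L.)
-/

open Finset
open Summit.QuantumAdvantage.AdviceFreeQNC0
open Summit.QuantumAdvantage.QuantumAdvantage.Theorems.InnerDegreeDial

namespace Summit.QuantumAdvantage.QuantumAdvantage.Theorems.LivenessSeparation

variable {p : ℕ} [Fact p.Prime] {n : ℕ}

/-- **THE DESIGNED-CLASS RECTANGLE KILL.**  Registers `k`-form outside a set `Q` of cuts lying outside the block `[a₀, a₀+m)`; at one input `fill ρ T v₀` of the
class `τ` the cut `g₀ ∈ Q` is live and every other member of `Q` is dead (hence on the whole class, part J); a disjoint-support rectangle inside the class on which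
`y g₀` fires as a row-dependent non-constant one-label table `G_i(⟨(1,a_i), N w + w₀⟩)`, `a` injective, `N` invertible; `|ι| > (n+1)·2p^k + 1` ⇒ `y` loses. -/
theorem loss_of_designedClassRectangle (hp5 : 5 ≤ p) {k r m : ℕ} {ι : Type*} [Fintype ι] (c : ℕ)
    (y : Fin (n + 1) → (Fin n → Bool) → Bool) (ρ : Fin n → Bool) (a₀ : ℕ) (h : a₀ + m ≤ n)
    (Q : Finset (Fin (n + 1))) (hQ : ∀ g ∈ Q, g.val ≤ a₀ ∨ a₀ + m ≤ g.val) (g₀ : Fin (n + 1)) (hg₀ : g₀ ∈ Q)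
    (τ : ℕ) (v₀ : Fin m → Bool) (hv₀ : (univ.filter fun j => v₀ j = true).card % 3 = τ % 3)
    (hlive₀ : liveCut c (fill ρ (blockEmb a₀ m h) v₀) g₀ = true)
    (hdead : ∀ g ∈ Q, g ≠ g₀ → liveCut c (fill ρ (blockEmb a₀ m h) v₀) g = false)
    (lam : Fin (n + 1) → Fin k → Fin n → ZMod p) (F : Fin (n + 1) → (Fin k → ZMod p) → Bool)
    (hF : ∀ g, g ∉ Q → ∀ u, y g u = F g (fun j => ∑ i, if u i = true then lam g j i else 0))
    (X : ι → Fin n → Bool) (Y : (Fin (r + 1) → ZMod p) → Fin n → Bool)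
    (hd : ∀ i w l, ¬ (X i l = true ∧ Y w l = true))
    (hcl : ∀ i w, ∃ v : Fin m → Bool, (univ.filter fun j => v j = true).card % 3 = τ % 3 ∧
      bor (X i) (Y w) = fill ρ (blockEmb a₀ m h) v)
    (G : ι → ZMod p → Bool) (hG : ∀ i, ∃ b b', G i b ≠ G i b')
    (a : ι → Fin r → ZMod p) (ha : Function.Injective a) (w₀ : Fin (r + 1) → ZMod p)
    (N N' : Matrix (Fin (r + 1)) (Fin (r + 1)) (ZMod p)) (hN : N * N' = 1)
    (hpat : ∀ i w, y g₀ (bor (X i) (Y w)) = G i (lineRep p r (a i) ⬝ᵥ (N.mulVec w + w₀)))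
    (ht : (n + 1) * (p ^ k * 2) + 1 < Fintype.card ι) :
    ∃ u, ringWinU c y u = false := by
  classical
  -- the design: no member of `Q` other than `g₀` is live at `v₀`
  have hQl : (Q.filter fun g => liveCut c (fill ρ (blockEmb a₀ m h) v₀) g = true).erase g₀ = ∅ := by
    refine Finset.eq_empty_of_forall_notMem ?_
    intro g hg
    rw [mem_erase, mem_filter] at hg
    have h1 := hdead g hg.2.1 hg.1
    rw [h1] at hg
    exact Bool.false_ne_true hg.2.2
  have hg₀d : g₀ ∉ Q.filter (fun g => liveCut c (fill ρ (blockEmb a₀ m h) v₀) g = false) := by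
    rw [mem_filter, hlive₀]
    simp
  by_contra hno
  push Not at hno
  have hperf : ∀ u, ringWinU c y u = true := fun u => by
    cases hu : ringWinU c y u
    · exact absurd hu (hno u)
    · rfl
  -- silencing `Q ∖ {g₀}` keeps the wins on the class (part J with an empty live set)
  have hwin : ∀ i w, ringWinU c (mergeSet (silenceSet y (Q.filter fun g => liveCut c (fill ρ (blockEmb a₀ m h) v₀) g = false)) g₀ ∅)
      (bor (X i) (Y w)) = true := by
    intro i w
    obtain ⟨v, hv, hb⟩ := hcl i w
    rw [hb, ← hQl]
    exact winsOn_class_normalForm c y hperf ρ a₀ h Q hQ g₀ hg₀ τ v₀ hv₀ hlive₀ v hv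
  -- the exceptional register is unchanged
  have hself : ∀ u, mergeSet (silenceSet y (Q.filter fun g => liveCut c (fill ρ (blockEmb a₀ m h) v₀) g = false)) g₀ ∅ g₀ u = y g₀ u := by
    intro u
    rw [classNormalForm_self y hg₀d (fun g hg => absurd hg (notMem_empty g)) u]
    simp
  -- the silenced strategy is `k`-form except `g₀`
  have hF' : ∀ g, g ≠ g₀ → ∀ u, mergeSet (silenceSet y (Q.filter fun g => liveCut c (fill ρ (blockEmb a₀ m h) v₀) g = false)) g₀ ∅ g u
      = (fun g => if g ∈ Q then (fun _ => false) else F g) g (fun j => ∑ i, if u i = true then lam g j i else 0) := by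
    intro g hg u
    by_cases hq : g ∈ Q
    · simp only [hq, if_true]
      exact classNormalForm_of_mem y (Or.inl (mem_filter.mpr ⟨hq, hdead g hq hg⟩)) hg u
    · simp only [hq, if_false]
      rw [classNormalForm_of_not_mem y (fun hm => hq (mem_filter.mp hm).1) (notMem_empty g) hg u]
      exact hF g hq u
  -- LAW R from the wins on the rectangle (part F)
  have hR := rectRank_le_of_winsOn hp5 c _ g₀ lam (fun g => if g ∈ Q then (fun _ => false) else F g) hF' X Y hd hwin
  -- `g₀` is live on the rectangle (constancy of liveness on the class, part J)
  have hliveR : ∀ i w, liveCut c (bor (X i) (Y w)) g₀ = true := by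
    intro i w
    obtain ⟨v, hv, hb⟩ := hcl i w
    rw [hb, liveCut_fill_block_outside c ρ a₀ h g₀ (hQ g₀ hg₀) v v₀ (by rw [hv, hv₀])]
    exact hlive₀
  -- the rectangle is a one-label family pattern (tree, InnerDegreeLawsJ)
  have hrect : rect (Kp p) (fun u => mergeSet (silenceSet y (Q.filter fun g => liveCut c (fill ρ (blockEmb a₀ m h) v₀) g = false)) g₀ ∅ g₀ u
        && liveCut c u g₀) X Y
      = Matrix.of fun i (w : Fin (r + 1) → ZMod p) =>
          (fun i z => if G i z = true then (1 : Kp p) else 0) i (lineRep p r (a i) ⬝ᵥ (N.mulVec w + w₀)) := by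
    ext i w
    rw [rect, Matrix.of_apply, Matrix.of_apply]
    simp only [hself, hpat i w, hliveR i w, Bool.and_true]
  obtain ⟨hK, ω, -, hω, -⟩ := Coset21.exists_charTwo_roots p hp5
  haveI := hK
  have hG' : ∀ i, ∃ x x', (fun i z => if G i z = true then (1 : Kp p) else 0) i x
      ≠ (fun i z => if G i z = true then (1 : Kp p) else 0) i x' := by
    intro i
    obtain ⟨b, b', hb⟩ := hG i
    refine ⟨b, b', ?_⟩
    intro h
    apply hb
    cases h1 : G i b <;> cases h2 : G i b' <;> simp_all
  have hge := rank_famPat_flat_ge hp5 hω a ha (fun i z => if G i z = true then (1 : Kp p) else 0) hG' w₀ N N' hN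
  rw [← hrect] at hge
  omega

end Summit.QuantumAdvantage.QuantumAdvantage.Theorems.LivenessSeparation
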